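import Summits.QuantumFields.YangMills.Theorems.BalabanUVNodesN15KingModelFullPropagatorMixedRateProfile
import Summits.QuantumFields.YangMills.Theorems.BalabanUVNodesN15KingModelFullPropagatorMixedPowerLaw
import Summits.QuantumFields.YangMills.Theorems.BalabanUVNodesN15KingModelFullPropagatorRatePowerLaw

/-!
# BalabanUVNodes ∕ N15 — THE KING-MODEL RUNG, CURVED EDITION (PART Φ-c): THE TWO-SPACING η-RATE OF THE MIXED SECOND DIFFERENCE WITH THE
# SCALE-COVARIANT RATE FACTOR — `|DD′_{μν}G^{η′}_{K+n}(x′, y′) − DD_{μν}G^η_K(x, y)| ≤ C·((L^nL^K)∕r′)^{d+1}·((L^n)∕r′)^{γ∕2}` =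
# `C·|x′ − y′|^{−(d+1)}·(η∕|x′ − y′|)^{γ∕2}` in unit coordinates (King's (3.73) with `|a| = |b| = 1`, SUMMED over (2.17)), for ALL `x′ ≠ y′`, UNIFORMLY in
# `K`, `n`, the volume and the mass — the last entry of the `|a|, |b| ≤ 1` two-spacing table of the FULL `A = 0` propagator (S-b `(0,0)`, S-d `(1,0)`, S-d v1.1 `(0,1)`)
# (Track A, DAG node N15 = NE2; FAN-OUT v1.1 §N15 s3 «KING-MODEL RUNG … + the one-line statement of what the curved case adds»)

HONEST FRAMING.  Count-neutral kernel bookkeeping (cell `pub-ymgap`, seat `pub-ymgap-dag-n15-e` g10; `--supports stmt-QuantumFields-20544 --as helper` = K3⁷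
`SpineGivenEndpointR13SepCoPH`, WORDS-143).  TEMPLATE LITERATURE, `A = 0`: C. King's scalar U(1)-Higgs MODEL on finite tori ([King1986] (2.13)–(2.17) p. 653,
Prop. 3.7 (3.63) p. 663, Prop. 3.9 (3.73) p. 665 «`|D^a_{x′}D^b_{y′}G^{η′}_{(j)}(x′, y′) − D^a_xD^b_yG^η_{(j)}(x, y)| ≤ C(L^{−γk})(L^jη)^{2−d−|a|−|b|−γ}exp[…]`»;
King's `d` = this file's `d + 1`, so the summed exponent `2 − d_K − 2` of the mixed clause is `−(d + 1)`), NOT Bałaban's covariant objects.  The statements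
below are the (2.17)-SUMMED SHAPE of that clause for the FULL propagator's mixed second difference — the kernel of [B9]'s (3.44)∕(3.45) objects `∇_UG∇*_U`
at `U ≡ 1` — with the `T4EtaRate.rateFactor` «(spacing ∕ size)^γ» read at the pair's own scale `|x′ − y′|`; decided in the MODEL; NOT a printed proposition;
NE2⁺ is NOT PRINTED and not proved here; NOT a node discharge; nothing continuum ∕ ℝ⁴ ∕ OS ∕ mass-gap ∕ Clay.  0 `sorry`, 0 `def`, standard axioms.
* ★★ **`fullPropDD_ratePowerLaw_unif`** (resolved pairs `r′ ≥ L^n`: part Φ-b's profile summed by part S-b `levelSum_rate_le` ∕ `unpairedSum_le` at `p = d + 1`);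
  ★ `fullPropDD_ratePowerLaw_all` (every `x′ ≠ y′`: below the coarse spacing the rate factor is `≥ 1` and part V-a `fullPropDD_powerLaw_unif` ∕
  `fullPropDD_diag_le_unif` bound the two kernels separately).
WHAT THE CURVED CASE ADDS (one line): the same two-spacing power law for `∇_UG_k(U)∇*_U` uniformly over `Reg335` — not printed ([B9] prints η-uniformity).
HONEST SCOPE.  (i) `A = 0`, periodic b.c., odd `L ≥ 3`, `0 < m² ≤ m₀²`, cubes `2L^e`, `K, n ≥ 1`, every `d ≥ 0`; (ii) lattice units; sup torus distance;
King's pairing; forward η-differences in both variables; (iii) `0 ≤ γ < 1`; (iv) not Bałaban's `G_k(U)`; not a discharge.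
Locators: [King1986] (2.13)–(2.17) p. 653, (2.20) p. 654, Prop. 3.7 (3.63) p. 663, Prop. 3.9 (3.73) p. 665, (4.42)–(4.43) p. 675.
-/

noncomputable section

namespace Summit.QuantumFields.YangMills.BalabanUVNodes.N15KingModelRung.Curved

open Real Finset Matrix
open Literature.MathematicalPhysics.QuantumFieldTheory.Balaban1983to89.B5Prop11Plancherel (Tor fine unitVec)
open Literature.MathematicalPhysics.QuantumFieldTheory.King1986 (aK aK_pos)
open Literature.MathematicalPhysics.QuantumFieldTheory.King1986.Torus (constrainedProp tdistT tdistT_nonneg)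

variable {d : ℕ} (L : ℕ) [NeZero L]

/-- ★★ **THE TWO-SPACING η-RATE POWER LAW OF THE MIXED SECOND DIFFERENCE OF KING'S FULL `A = 0` FLUCTUATION PROPAGATOR, ALL RESOLVED PAIRS**
(`0 ≤ γ < 1`): for odd `L ≥ 3`, `a > 0`, `m₀² ≥ 0` there is `C > 0` (a function of `d, L, a, m₀², γ`) such that for EVERY `K ≥ 1`, `n ≥ 1`, cube
`M_μ = 2L^e`, mass `0 < m² ≤ m₀²`, directions `μ, ν` and ALL fine points `x′, y′` of the `(K+n)`-level run at fine distance `r′ ≥ L^n` (`|x′ − y′| ≥ η`), with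
`x = underPtN x′`, `y = underPtN y′`, `N′ = L^nL^K`:
`|N′(N′[G′(x′+e_μ, y′+e_ν) − G′(x′, y′+e_ν)] − N′[G′(x′+e_μ, y′) − G′(x′, y′)]) − L^K(L^K[G(x+e_μ, y+e_ν) − G(x, y+e_ν)] − L^K[G(x+e_μ, y) − G(x, y)])|
≤ C·(L^nL^K∕r′)^{d+1}·(L^n∕r′)^{γ∕2}` = `C·|x′ − y′|^{−(d+1)}·(η∕|x′ − y′|)^{γ∕2}` in unit coordinates — (3.73) with `|a| = |b| = 1` summed, UNIFORM in `K`, `n`,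
the volume and the mass (part Φ-b + part S-b §1 at `p = d + 1`).  NOT a printed proposition; nothing here is Bałaban's `∇G_k(U)∇*`.
[cite: King1986, (2.13)–(2.17) p.653, (2.20) p.654, Prop. 3.7 (3.63) p.663, Prop. 3.9 (3.73) p.665, (4.42)–(4.43) p.675] -/
theorem fullPropDD_ratePowerLaw_unif (hLodd : Odd L) (hL : 2 ≤ L) {a : ℝ} (ha : 0 < a) {m0sq : ℝ} (hm0 : 0 ≤ m0sq)
    {γ : ℝ} (hγ0 : 0 ≤ γ) (hγ1 : γ < 1) :
    ∃ C : ℝ, 0 < C ∧ ∀ (K : ℕ), 1 ≤ K → ∀ (n : ℕ), 1 ≤ n →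
      ∀ (e : ℕ) (M : Fin (d + 1) → ℕ) [∀ μ, NeZero (M μ)], (∀ μ, M μ = 2 * L ^ e) →
      ∀ (msq : ℝ), 0 < msq → msq ≤ m0sq →
      ∀ (μ ν : Fin (d + 1)) (x' y' : Tor (fine (L ^ n * L ^ K) M)), ((L ^ n : ℕ) : ℝ) ≤ tdistT (fine (L ^ n * L ^ K) M) x' y' →
        |((L ^ n * L ^ K : ℕ) : ℝ) * (((L ^ n * L ^ K : ℕ) : ℝ) *
              (constrainedProp (L ^ n * L ^ K) M (aK a L (K + n)) (((L ^ n * L ^ K : ℕ) : ℝ) ^ 2) msq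
                  (x' + unitVec (fine (L ^ n * L ^ K) M) μ) (y' + unitVec (fine (L ^ n * L ^ K) M) ν)
                - constrainedProp (L ^ n * L ^ K) M (aK a L (K + n)) (((L ^ n * L ^ K : ℕ) : ℝ) ^ 2) msq
                  x' (y' + unitVec (fine (L ^ n * L ^ K) M) ν))
            - ((L ^ n * L ^ K : ℕ) : ℝ) *
              (constrainedProp (L ^ n * L ^ K) M (aK a L (K + n)) (((L ^ n * L ^ K : ℕ) : ℝ) ^ 2) msq
                  (x' + unitVec (fine (L ^ n * L ^ K) M) μ) y'
                - constrainedProp (L ^ n * L ^ K) M (aK a L (K + n)) (((L ^ n * L ^ K : ℕ) : ℝ) ^ 2) msq x' y'))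
          - ((L ^ K : ℕ) : ℝ) * (((L ^ K : ℕ) : ℝ) *
              (constrainedProp (L ^ K) M (aK a L K) (((L ^ K : ℕ) : ℝ) ^ 2) msq
                  (underPtN L K n M x' + unitVec (fine (L ^ K) M) μ) (underPtN L K n M y' + unitVec (fine (L ^ K) M) ν)
                - constrainedProp (L ^ K) M (aK a L K) (((L ^ K : ℕ) : ℝ) ^ 2) msq
                  (underPtN L K n M x') (underPtN L K n M y' + unitVec (fine (L ^ K) M) ν))
            - ((L ^ K : ℕ) : ℝ) *
              (constrainedProp (L ^ K) M (aK a L K) (((L ^ K : ℕ) : ℝ) ^ 2) msq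
                  (underPtN L K n M x' + unitVec (fine (L ^ K) M) μ) (underPtN L K n M y')
                - constrainedProp (L ^ K) M (aK a L K) (((L ^ K : ℕ) : ℝ) ^ 2) msq (underPtN L K n M x') (underPtN L K n M y')))|
          ≤ C * (((L ^ n * L ^ K : ℕ) : ℝ) / tdistT (fine (L ^ n * L ^ K) M) x' y') ^ (d + 1)
              * (((L ^ n : ℕ) : ℝ) / tdistT (fine (L ^ n * L ^ K) M) x' y') ^ (γ / 2) := by
  have hLr : (2 : ℝ) ≤ L := by exact_mod_cast hL
  have hL0 : (0 : ℝ) < L := by linarith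
  have hp : 1 ≤ d + 1 := by omega
  have hs0 : 0 ≤ γ / 2 := by linarith
  have hs1 : γ / 2 ≤ 1 := by linarith [hγ1.le]
  obtain ⟨C₀, δ, hC₀, hδ, H⟩ := fullPropDD_rateProfile_unif (d := d) L hLodd hL ha hm0 hγ0 hγ1
  -- the two summation constants
  set A₁ : ℝ := 2 * δ ^ (-(γ / 2)) * ((2 * (d + 1 + 1).factorial / (δ / 2 / L) ^ (d + 1 + 1) + 2) / (L : ℝ) ^ (d + 1)) with hA₁
  set A₂ : ℝ := 2 * (d + 1 + 1).factorial / δ ^ (d + 1 + 1) with hA₂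
  have hA₁0 : 0 < A₁ := by
    have : 0 < δ ^ (-(γ / 2)) := Real.rpow_pos_of_pos hδ _
    positivity
  have hA₂0 : 0 < A₂ := by positivity
  refine ⟨C₀ * (A₁ + A₂), by positivity, ?_⟩
  intro K hK n hn e M _ hM msq hmsq hcap μ ν x' y' hres
  have h := H K hK n hn e M hM msq hmsq hcap μ ν x' y'
  set r' : ℝ := tdistT (fine (L ^ n * L ^ K) M) x' y' with hr'def
  set Ln : ℝ := ((L ^ n : ℕ) : ℝ) with hLndef
  have hLn : Ln = (L : ℝ) ^ n := by rw [hLndef]; push_cast; ring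
  have hLn0 : 0 < Ln := by rw [hLn]; positivity
  have hr'0 : 0 < r' := lt_of_lt_of_le hLn0 hres
  -- the resolved distance in coarse-spacing units `ρ = r′∕L^n ≥ 1`
  set ρ : ℝ := r' / Ln with hρdef
  have hρ : 1 ≤ ρ := by rw [hρdef, le_div_iff₀ hLn0, one_mul]; exact hres
  have hρ0 : 0 < ρ := by linarith
  have hNc : ((L ^ n * L ^ K : ℕ) : ℝ) = Ln * (L : ℝ) ^ K := by rw [hLndef]; push_cast; ring
  -- the exponents of part Φ-b in the variable `ρ`: `r′·L^m∕N′ = ρ·L^m∕L^K`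
  have hexp : ∀ m : ℕ, r' * (L : ℝ) ^ m / ((L ^ n * L ^ K : ℕ) : ℝ) = ρ * (L : ℝ) ^ m / (L : ℝ) ^ K := fun m => by
    rw [hNc, hρdef]
    field_simp
  have hΛφ : (L : ℝ) ^ (d + 1) / (L : ℝ) ^ 2 * L * L * (L : ℝ) ^ (γ / 2) = (L : ℝ) ^ (d + 1) * (L : ℝ) ^ (γ / 2) := by
    rw [LamL2_eq_pow L hL]
  have hPS : ((L : ℝ) ^ (-(γ / 2))) ^ K
        * ∑ i ∈ Finset.range K, ((L : ℝ) ^ (d + 1) / (L : ℝ) ^ 2 * L * L * (L : ℝ) ^ (γ / 2)) ^ i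
            * Real.exp (-(δ * (r' * (L : ℝ) ^ i / ((L ^ n * L ^ K : ℕ) : ℝ))))
      = ((L : ℝ) ^ (-(γ / 2))) ^ K
        * ∑ i ∈ Finset.range K, ((L : ℝ) ^ (d + 1) * (L : ℝ) ^ (γ / 2)) ^ i
            * Real.exp (-(δ * (ρ * (L : ℝ) ^ i / (L : ℝ) ^ K))) := by
    congr 1
    exact Finset.sum_congr rfl fun i _ => by rw [hΛφ, hexp]
  have hUS : ∑ i ∈ Finset.range n, ((L : ℝ) ^ (d + 1) / (L : ℝ) ^ 2 * L * L) ^ (K + i)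
          * Real.exp (-(δ * (r' * (L : ℝ) ^ (K + i) / ((L ^ n * L ^ K : ℕ) : ℝ))))
      = ∑ i ∈ Finset.range n, ((L : ℝ) ^ (d + 1)) ^ (K + i) * Real.exp (-(δ * (ρ * (L : ℝ) ^ (K + i) / (L : ℝ) ^ K))) :=
    Finset.sum_congr rfl fun i _ => by rw [LamL2_eq_pow L hL, hexp]
  rw [hPS, hUS] at h
  -- part S-b §1 at `p = d + 1`
  have h1 := levelSum_rate_le hLr hδ hp hs0 hs1 K hρ
  have h2 := unpairedSum_le hLr hδ (d + 1) K n hρ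
  -- `ρ⁻¹ ≤ ρ^{−γ∕2}` (`ρ ≥ 1`)
  have hρinv : ρ⁻¹ ≤ ρ ^ (-(γ / 2)) := by
    rw [← Real.rpow_neg_one]
    exact Real.rpow_le_rpow_of_exponent_le hρ (by linarith)
  have hPow0 : 0 ≤ ((L : ℝ) ^ K / ρ) ^ (d + 1) := by positivity
  have h2' : ∑ i ∈ Finset.range n, ((L : ℝ) ^ (d + 1)) ^ (K + i) * Real.exp (-(δ * (ρ * (L : ℝ) ^ (K + i) / (L : ℝ) ^ K)))
      ≤ A₂ * ((L : ℝ) ^ K / ρ) ^ (d + 1) * ρ ^ (-(γ / 2)) :=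
    h2.trans (mul_le_mul_of_nonneg_left hρinv (by positivity))
  -- the two factors of the display in the variable `ρ`
  have hF1 : ((L ^ n * L ^ K : ℕ) : ℝ) / r' = (L : ℝ) ^ K / ρ := by
    rw [hNc, hρdef]
    field_simp
  have hF2 : Ln / r' = ρ⁻¹ := by rw [hρdef, inv_div]
  have hF3 : (ρ⁻¹) ^ (γ / 2) = ρ ^ (-(γ / 2)) := by
    rw [Real.inv_rpow hρ0.le, Real.rpow_neg hρ0.le]
  rw [hF1, hF2, hF3]
  refine h.trans ?_
  calc C₀ * (((L : ℝ) ^ (-(γ / 2))) ^ K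
            * ∑ i ∈ Finset.range K, ((L : ℝ) ^ (d + 1) * (L : ℝ) ^ (γ / 2)) ^ i
                * Real.exp (-(δ * (ρ * (L : ℝ) ^ i / (L : ℝ) ^ K)))
          + ∑ i ∈ Finset.range n, ((L : ℝ) ^ (d + 1)) ^ (K + i)
                * Real.exp (-(δ * (ρ * (L : ℝ) ^ (K + i) / (L : ℝ) ^ K))))
      ≤ C₀ * (A₁ * ((L : ℝ) ^ K / ρ) ^ (d + 1) * ρ ^ (-(γ / 2)) + A₂ * ((L : ℝ) ^ K / ρ) ^ (d + 1) * ρ ^ (-(γ / 2))) := by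
        refine mul_le_mul_of_nonneg_left (add_le_add ?_ h2') hC₀.le
        rw [hA₁]
        exact h1
    _ = C₀ * (A₁ + A₂) * ((L : ℝ) ^ K / ρ) ^ (d + 1) * ρ ^ (-(γ / 2)) := by ring

/-- ★ **THE MIXED TWO-SPACING POWER LAW FOR ALL DISTINCT PAIRS** (`0 ≤ γ < 1`): the bound of `fullPropDD_ratePowerLaw_unif`,
`|DD′G′(x′, y′) − DDG(x, y)| ≤ C·(L^nL^K∕r′)^{d+1}·(L^n∕r′)^{γ∕2}`, holds for EVERY `x′ ≠ y′` — on the resolved pairs `r′ ≥ L^n` it is the previous theorem;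
below the coarse spacing (`1 ≤ r′ < L^n`) the rate factor `(L^n∕r′)^{γ∕2} ≥ 1` and the two kernels are bounded separately by the fine run's own singularity
`(L^nL^K∕r′)^{d+1}` (part V-a `fullPropDD_powerLaw_unif` at `K + n` levels) and the coarse diagonal order `(L^K)^{d+1} ≤ (L^nL^K∕r′)^{d+1}` (part V-a
`fullPropDD_diag_le_unif`).  One display, uniform in `K`, `n`, the volume and the mass. [cite: King1986, (2.13)–(2.17) p.653, Prop. 3.7 (3.63) p.663, Prop. 3.9 (3.73) p.665] -/
theorem fullPropDD_ratePowerLaw_all (hLodd : Odd L) (hL : 2 ≤ L) {a : ℝ} (ha : 0 < a) {m0sq : ℝ} (hm0 : 0 ≤ m0sq)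
    {γ : ℝ} (hγ0 : 0 ≤ γ) (hγ1 : γ < 1) :
    ∃ C : ℝ, 0 < C ∧ ∀ (K : ℕ), 1 ≤ K → ∀ (n : ℕ), 1 ≤ n →
      ∀ (e : ℕ) (M : Fin (d + 1) → ℕ) [∀ μ, NeZero (M μ)], (∀ μ, M μ = 2 * L ^ e) →
      ∀ (msq : ℝ), 0 < msq → msq ≤ m0sq →
      ∀ (μ ν : Fin (d + 1)) (x' y' : Tor (fine (L ^ n * L ^ K) M)), x' ≠ y' →
        |((L ^ n * L ^ K : ℕ) : ℝ) * (((L ^ n * L ^ K : ℕ) : ℝ) *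
              (constrainedProp (L ^ n * L ^ K) M (aK a L (K + n)) (((L ^ n * L ^ K : ℕ) : ℝ) ^ 2) msq
                  (x' + unitVec (fine (L ^ n * L ^ K) M) μ) (y' + unitVec (fine (L ^ n * L ^ K) M) ν)
                - constrainedProp (L ^ n * L ^ K) M (aK a L (K + n)) (((L ^ n * L ^ K : ℕ) : ℝ) ^ 2) msq
                  x' (y' + unitVec (fine (L ^ n * L ^ K) M) ν))
            - ((L ^ n * L ^ K : ℕ) : ℝ) *
              (constrainedProp (L ^ n * L ^ K) M (aK a L (K + n)) (((L ^ n * L ^ K : ℕ) : ℝ) ^ 2) msq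
                  (x' + unitVec (fine (L ^ n * L ^ K) M) μ) y'
                - constrainedProp (L ^ n * L ^ K) M (aK a L (K + n)) (((L ^ n * L ^ K : ℕ) : ℝ) ^ 2) msq x' y'))
          - ((L ^ K : ℕ) : ℝ) * (((L ^ K : ℕ) : ℝ) *
              (constrainedProp (L ^ K) M (aK a L K) (((L ^ K : ℕ) : ℝ) ^ 2) msq
                  (underPtN L K n M x' + unitVec (fine (L ^ K) M) μ) (underPtN L K n M y' + unitVec (fine (L ^ K) M) ν)
                - constrainedProp (L ^ K) M (aK a L K) (((L ^ K : ℕ) : ℝ) ^ 2) msq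
                  (underPtN L K n M x') (underPtN L K n M y' + unitVec (fine (L ^ K) M) ν))
            - ((L ^ K : ℕ) : ℝ) *
              (constrainedProp (L ^ K) M (aK a L K) (((L ^ K : ℕ) : ℝ) ^ 2) msq
                  (underPtN L K n M x' + unitVec (fine (L ^ K) M) μ) (underPtN L K n M y')
                - constrainedProp (L ^ K) M (aK a L K) (((L ^ K : ℕ) : ℝ) ^ 2) msq (underPtN L K n M x') (underPtN L K n M y')))|
          ≤ C * (((L ^ n * L ^ K : ℕ) : ℝ) / tdistT (fine (L ^ n * L ^ K) M) x' y') ^ (d + 1)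
              * (((L ^ n : ℕ) : ℝ) / tdistT (fine (L ^ n * L ^ K) M) x' y') ^ (γ / 2) := by
  obtain ⟨C₀, hC₀, H₀⟩ := fullPropDD_ratePowerLaw_unif (d := d) L hLodd hL ha hm0 hγ0 hγ1
  obtain ⟨C₁, hC₁, H₁⟩ := fullPropDD_powerLaw_unif (d := d) L hLodd hL ha hm0
  obtain ⟨C₂, hC₂, H₂⟩ := fullPropDD_diag_le_unif (d := d) L hLodd hL ha hm0
  refine ⟨max C₀ (C₁ + C₂), lt_max_of_lt_left hC₀, ?_⟩
  intro K hK n hn e M _ hM msq hmsq hcap μ ν x' y' hxy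
  set r' : ℝ := tdistT (fine (L ^ n * L ^ K) M) x' y' with hr'def
  set Ln : ℝ := ((L ^ n : ℕ) : ℝ) with hLndef
  set N' : ℝ := ((L ^ n * L ^ K : ℕ) : ℝ) with hN'def
  have hr1 : 1 ≤ r' := one_le_tdistT_of_ne (fine (L ^ n * L ^ K) M) hxy
  have hr0 : 0 < r' := by linarith
  have hLn0 : 0 < Ln := by rw [hLndef]; exact_mod_cast Nat.pos_of_ne_zero (pow_ne_zero _ (by omega))
  have hN'eq : N' = Ln * (L : ℝ) ^ K := by rw [hN'def, hLndef]; push_cast; ring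
  have hF0 : 0 ≤ (N' / r') ^ (d + 1) := by positivity
  have hR0 : 0 ≤ (Ln / r') ^ (γ / 2) := Real.rpow_nonneg (by positivity) _
  rcases le_or_gt Ln r' with hres | hlow
  · calc _ ≤ C₀ * (N' / r') ^ (d + 1) * (Ln / r') ^ (γ / 2) := H₀ K hK n hn e M hM msq hmsq hcap μ ν x' y' hres
      _ ≤ max C₀ (C₁ + C₂) * (N' / r') ^ (d + 1) * (Ln / r') ^ (γ / 2) :=
          mul_le_mul_of_nonneg_right (mul_le_mul_of_nonneg_right (le_max_left _ _) hF0) hR0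
  · have hfine := H₁ (K + n) (by omega) (L ^ n * L ^ K) (by rw [pow_add, mul_comm]) e M hM msq hmsq hcap μ ν x' y' hxy
    have hcoarse := H₂ K hK (L ^ K) rfl e M hM msq hmsq hcap μ ν (underPtN L K n M x') (underPtN L K n M y')
    have hpow : ((L : ℝ) ^ (K + n)) / r' = N' / r' := by rw [hN'eq, hLndef, pow_add]; push_cast; ring
    rw [hpow] at hfine
    have hKle : (L : ℝ) ^ K ≤ N' / r' := by
      rw [le_div_iff₀ hr0, hN'eq]
      nlinarith [pow_pos (show (0 : ℝ) < L by exact_mod_cast (show 0 < L by omega)) K]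
    have hdiag : ((L : ℝ) ^ K) ^ (d + 1) ≤ (N' / r') ^ (d + 1) := pow_le_pow_left₀ (by positivity) hKle _
    have hrate : 1 ≤ (Ln / r') ^ (γ / 2) := Real.one_le_rpow (by rw [le_div_iff₀ hr0, one_mul]; exact hlow.le) (by linarith)
    refine ((abs_sub _ _).trans (add_le_add hfine hcoarse)).trans ?_
    calc C₁ * (N' / r') ^ (d + 1) + C₂ * ((L : ℝ) ^ K) ^ (d + 1)
        ≤ C₁ * (N' / r') ^ (d + 1) + C₂ * (N' / r') ^ (d + 1) := by
          have := mul_le_mul_of_nonneg_left hdiag hC₂.le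
          linarith
      _ = (C₁ + C₂) * (N' / r') ^ (d + 1) * 1 := by ring
      _ ≤ max C₀ (C₁ + C₂) * (N' / r') ^ (d + 1) * (Ln / r') ^ (γ / 2) :=
          mul_le_mul (mul_le_mul_of_nonneg_right (le_max_right _ _) hF0) hrate zero_le_one (by positivity)

end Summit.QuantumFields.YangMills.BalabanUVNodes.N15KingModelRung.Curved
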